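import Mathlib.Algebra.EuclideanDomain.Basic
import Mathlib.Tactic.LinearCombination
import Literature.Algebra.EuclideanDomain.TransfiniteSmallestAlgorithm
import HarnessLib

/-!
# Mathlib's Euclidean domains are exactly the domains exhausted by Samuel's transfinite construction
# (Samuel 1971, §4: «The ring `A` is Euclidean iff this sequence exhausts the ring `A`», and Prop. 11)

Topic `Literature/Algebra/EuclideanDomain`, namespace `Literature.Algebra.EuclideanDomain`.  THEOREMS ONLY (no `def`, no
instance, no named fact), all proved.  Mathlib's `EuclideanDomain R` asks for a quotient and a remainder function, a
WELL-FOUNDED RELATION `≺` on `R` (not necessarily a linear order, not necessarily with values anywhere) with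
`a % b ≺ b`, and `¬ (a * b ≺ a)` for `b ≠ 0`.  This file identifies that class, up to ring isomorphism, with Samuel's
transfinite notion in the vocabulary of `TransfiniteSmallestAlgorithm.lean` (`samuelSet R α = A_α`, `samuelRank = θ`).

## Source (read at the page)

P. Samuel, *About Euclidean rings*, J. Algebra **19** (1971) 282–301 [Samuel1971] (materialised
`paper:doi-10-1016-0021-8693-71-90110-4`), VERBATIM.  §4 (p. 289): «The ring `A` is Euclidean iff this sequence
exhausts the ring `A`.  In this case the smallest algorithm `θ` on `A` is defined by `θ(x) = α ⟺ x ∈ A_α − A_α′`.»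
**Proposition 11** (p. 290): «Let `A` be a ring, `T` a partially ordered set with descending chain condition and
`φ : A → T` a mapping such that, given any `a` and `b ≠ 0` in `A`, there exist `q, r ∈ A` such that `a = bq + r` and
`φ(r) < φ(b)`.  Then `A` is Euclidean.»  (Proof: choose `b ∉ A′` with `φ(b)` minimal …)  §2 Prop. 4 (a) (p. 284), for the
smallest algorithm (p. 288): «`θ(ac) ≥ θ(a)` for `ac ≠ 0`».

## What is formalised

* `forall_exists_mem_samuelSet_of_euclideanDomain`: a Mathlib `EuclideanDomain` is exhausted by its transfinite
  construction — Proposition 11 with Mathlib's well-founded relation `≺` in place of `φ` (the proof of Prop. 11 uses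
  only well-foundedness: induction on `≺`, the remainders `a % b ≺ b` lie in `A′ = ⋃_α A_α`, hence so does `b`, by
  `mem_iUnion_samuelSet_of_forall`); consequently `θ` is an ordinal-valued algorithm on it
  (`samuelRank_isAlgorithm_of_euclideanDomain`).
* `exists_euclideanDomain_of_forall_exists_mem_samuelSet`: conversely a DOMAIN exhausted by its construction carries an
  `EuclideanDomain` structure (built inside the proof, no definition is declared): quotient and remainder chosen from
  (E) for `θ`, `≺` is `θ a < θ b`, and `¬ θ(ab) < θ(a)` is Prop. 4 (a) for `θ` (`samuelRank_le_samuelRank_mul`) — this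
  last axiom is why zero-divisors must be excluded.
* **`exists_euclideanDomain_iff_forall_exists_mem_samuelSet`**: for a domain `R`, «some Euclidean domain is
  ring-isomorphic to `R`» (the tree's phrasing of «`R` is Euclidean», cf. `OfEuclideanFunction.exists_euclideanDomain`)
  iff `⋃_α A_α = R` iff `R` has an ordinal-valued algorithm.

## Mathlib / tree search

Mathlib: `EuclideanDomain` (`div_add_mod`, `mod_lt`, `r_wellFounded`, the `IsDomain` instance), `RingEquiv`.  Tree:
`TransfiniteSmallestAlgorithm.lean` (`mem_iUnion_samuelSet_of_forall`, `samuelRank_isAlgorithm`,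
`exists_mem_samuelSet_of_algorithm`, `samuelRank_le_samuelRank_mul`, `exists_algorithm_iff_forall_exists_mem_samuelSet`),
`OfEuclideanFunction.lean` (`IsEuclideanFunction.toEuclideanDomain`, the `ℕ`-valued analogue),
`ProductOfEuclideanRings.lean` (`algorithm_comp_ringEquiv_symm`; the transport is redone inline here to keep this file
independent of it).
-/

namespace Literature.Algebra.EuclideanDomain

universe u

/-! ## §1 A Mathlib Euclidean domain is exhausted by its transfinite construction -/

/-- **Proposition 11 for Mathlib's `EuclideanDomain`**: the well-founded relation `≺` with `a % b ≺ b` forces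
`⋃_α A_α = R` (well-founded induction on `≺`: all remainders mod `b` lie in `A′`, hence `b ∈ A′`).
[cite: Samuel1971, Prop. 11 (p. 290)] -/
theorem forall_exists_mem_samuelSet_of_euclideanDomain {R : Type u} [EuclideanDomain R] :
    ∀ x : R, ∃ α : Ordinal.{u}, x ∈ samuelSet R α := by
  intro x
  refine EuclideanDomain.r_wellFounded.induction (C := fun x ↦ ∃ α : Ordinal.{u}, x ∈ samuelSet R α) x
    fun b ih ↦ ?_
  by_cases hb : b = 0
  · exact ⟨0, hb ▸ zero_mem_samuelSet 0⟩
  · have H : b ∈ ⋃ α : Ordinal.{u}, samuelSet R α := by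
      refine mem_iUnion_samuelSet_of_forall fun a ↦ ?_
      obtain ⟨α, hα⟩ := ih (a % b) (EuclideanDomain.mod_lt a hb)
      exact ⟨a % b, Set.mem_iUnion.2 ⟨α, hα⟩, ⟨a / b, by linear_combination (-1 : R) * EuclideanDomain.div_add_mod a b⟩⟩
    exact Set.mem_iUnion.1 H

/-- Hence the smallest algorithm `θ` of a Mathlib Euclidean domain is an (ordinal-valued) algorithm on it: for `b ≠ 0`
every `a` is `bq + r` with `θ(r) < θ(b)`. [cite: Samuel1971, §4 (4.3) (p. 289)] -/
theorem samuelRank_isAlgorithm_of_euclideanDomain {R : Type u} [EuclideanDomain R] :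
    ∀ a b : R, b ≠ 0 → ∃ q r : R, a = b * q + r ∧ samuelRank r < samuelRank b :=
  samuelRank_isAlgorithm forall_exists_mem_samuelSet_of_euclideanDomain

/-- A ring isomorphic to a Mathlib Euclidean domain is exhausted by its transfinite construction (transport the
algorithm `θ_S ∘ e⁻¹`, then Prop. 11). [cite: Samuel1971, Prop. 11 (p. 290)] -/
theorem forall_exists_mem_samuelSet_of_ringEquiv {R : Type u} [CommRing R] {S : Type u} [EuclideanDomain S]
    (e : S ≃+* R) : ∀ x : R, ∃ α : Ordinal.{u}, x ∈ samuelSet R α := by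
  have hS := samuelRank_isAlgorithm_of_euclideanDomain (R := S)
  refine exists_mem_samuelSet_of_algorithm (fun x : R ↦ samuelRank (e.symm x)) (fun a b hb ↦ ?_)
  have hb' : e.symm b ≠ 0 := fun h ↦ hb (by simpa using congrArg e h)
  obtain ⟨q, r, h, hr⟩ := hS (e.symm a) (e.symm b) hb'
  refine ⟨e q, e r, e.symm.injective ?_, by simpa using hr⟩
  simp [map_add, map_mul, h]

/-! ## §2 A domain exhausted by its construction is a Euclidean domain in Mathlib's sense -/

/-- **«The ring `A` is Euclidean iff this sequence exhausts the ring `A`», Mathlib form, direction ⇐**: a domain with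
`⋃_α A_α = R` carries an `EuclideanDomain` structure — quotient and remainder from (E) for `θ`, `a ≺ b ⟺ θ(a) < θ(b)`,
and `¬ θ(ab) < θ(a)` for `b ≠ 0` by Prop. 4 (a) for `θ` (here the absence of zero-divisors is used).  The structure is
assembled inside the proof; the statement is the tree's «some Euclidean domain is ring-isomorphic to `R`».
[cite: Samuel1971, §4 (p. 289) and Prop. 4 (a) (p. 284)] -/
theorem exists_euclideanDomain_of_forall_exists_mem_samuelSet {R : Type u} [CommRing R] [IsDomain R]
    (h : ∀ x : R, ∃ α : Ordinal.{u}, x ∈ samuelSet R α) :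
    ∃ (S : Type u) (_ : EuclideanDomain S), Nonempty (S ≃+* R) := by
  classical
  have hE := samuelRank_isAlgorithm h
  let inst : EuclideanDomain R :=
    { (inferInstance : CommRing R), (inferInstance : Nontrivial R) with
      quotient := fun a b ↦ if hb : b = 0 then 0 else Classical.choose (hE a b hb)
      quotient_zero := fun a ↦ by simp
      remainder := fun a b ↦ if hb : b = 0 then a
        else Classical.choose (Classical.choose_spec (hE a b hb))
      quotient_mul_add_remainder_eq := fun a b ↦ by
        by_cases hb : b = 0
        · simp [hb]
        · simp only [hb, dite_false]
          exact (Classical.choose_spec (Classical.choose_spec (hE a b hb))).1.symm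
      r := fun a b ↦ samuelRank a < samuelRank b
      r_wellFounded := InvImage.wf samuelRank wellFounded_lt
      remainder_lt := fun a b hb ↦ by
        simp only [hb, dite_false]
        exact (Classical.choose_spec (Classical.choose_spec (hE a b hb))).2
      mul_left_not_lt := fun a b hb ↦ by
        change ¬samuelRank (a * b) < samuelRank a
        by_cases ha : a = 0
        · rw [ha, zero_mul]
          exact lt_irrefl _
        · exact not_lt.2 (samuelRank_le_samuelRank_mul (h _) (mul_ne_zero ha hb)) }
  exact ⟨R, inst, ⟨RingEquiv.refl R⟩⟩

/-- **«The ring `A` is Euclidean iff this sequence exhausts the ring `A`»** with «Euclidean» read as Mathlib's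
`EuclideanDomain` (up to ring isomorphism), for an integral domain `R`.
[cite: Samuel1971, §4 (p. 289) and Prop. 11 (p. 290)] -/
theorem exists_euclideanDomain_iff_forall_exists_mem_samuelSet {R : Type u} [CommRing R] [IsDomain R] :
    (∃ (S : Type u) (_ : EuclideanDomain S), Nonempty (S ≃+* R)) ↔
      ∀ x : R, ∃ α : Ordinal.{u}, x ∈ samuelSet R α := by
  constructor
  · rintro ⟨S, inst, ⟨e⟩⟩
    exact forall_exists_mem_samuelSet_of_ringEquiv e
  · exact exists_euclideanDomain_of_forall_exists_mem_samuelSet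

/-- The same with Samuel's Definition 1 on the right: a domain is (isomorphic to) a Mathlib Euclidean domain iff it has
an algorithm with values in the ordinals (equivalently, by `exists_ordinal_algorithm_of_algorithm`, in any well-ordered
set). [cite: Samuel1971, §4 (p. 289) and Prop. 11 (p. 290)] -/
theorem exists_euclideanDomain_iff_exists_algorithm {R : Type u} [CommRing R] [IsDomain R] :
    (∃ (S : Type u) (_ : EuclideanDomain S), Nonempty (S ≃+* R)) ↔
      ∃ φ : R → Ordinal.{u}, ∀ a b : R, b ≠ 0 → ∃ q r : R, a = b * q + r ∧ φ r < φ b := by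
  rw [exists_euclideanDomain_iff_forall_exists_mem_samuelSet, exists_algorithm_iff_forall_exists_mem_samuelSet]

/-- A single stage: a domain is (isomorphic to) a Mathlib Euclidean domain iff `A_α = R` for some ordinal `α`.
[cite: Samuel1971, §4 (p. 289)] -/
theorem exists_euclideanDomain_iff_exists_samuelSet_eq_univ {R : Type u} [CommRing R] [IsDomain R] :
    (∃ (S : Type u) (_ : EuclideanDomain S), Nonempty (S ≃+* R)) ↔ ∃ α : Ordinal.{u}, samuelSet R α = Set.univ := by
  rw [exists_euclideanDomain_iff_forall_exists_mem_samuelSet, exists_samuelSet_eq_univ_iff]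

end Literature.Algebra.EuclideanDomain
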